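import Literature.NumberTheory.DiophantineGeometry.GenEllThm21SupportMonotone
import Summits.ABC.ABC.Theorems.IUTThetaPilotGenEllTwo
import HarnessLib

set_option linter.dupNamespace false

/-!
# Route `route-ABC-IUTThetaPilot`: [GenEll] Thm. 2.1 (ii) ⟹ (i) for every support `Σ ⊆ {2}` — unconditional

S. Mochizuki, *Arithmetic elliptic curves in general position*, Math. J. Okayama Univ. **52** (2010),
Thm. 2.1 p. 11 [cite: MochizukiGenEll2010, Thm 2.1 p.11].  The cell's named fact
`GenEll.GenEll_thm21_primes` (frozen fact-list row F-1336) is the direction (ii) ⟹ (i) for EVERY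
finite set `Σ` of primes.  The route's support item `GenEllTwo` — now the tree's theorem
`Summit.ABC.ABC.Theorems.genEllTwo_holds` (stmt-ABC-19679, CLOSED · PROVED, package GENELLTWO-P1ROUTE
of abc-iut-S6) — is the case `Σ = {2}`.  Since statement (ii) is monotone along `⊆` in the support
(`GenEll.abcCompactlyBounded_of_subset`), the cases `Σ ⊆ {2}` (i.e. `Σ = ∅` and `Σ = {2}`) are
UNCONDITIONAL corollaries; and `GenEll_thm21_primes` itself is reduced to its prime sets `Σ ⊄ {2}`
(the `p`-generic version of the single-place spine — not attempted here).

Closing compositions only (proof-only; every step is in `Literature/` or in the GenEllTwo closer).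
Classical; no bearing on, and no side taken on, [IUTchIII] Cor. 3.12.
-/

noncomputable section

open Literature.NumberTheory.DiophantineGeometry.GenEll

namespace Summit.ABC.ABC.Theorems

/-- **[GenEll] Thm. 2.1, (ii) ⟹ (i) for `(ℙ¹, [0]+[1]+[∞])` at every `Σ ⊆ {2}`, UNCONDITIONALLY**:
if Vojta's height inequality holds (in every degree `≤ d`, every `ε > 0`) on every compactly bounded
subset of `U_P(Q̄)` whose support contains `Σ`, where `Σ = ∅` or `Σ = {2}`, then it holds on all of
`U_P(Q̄)^{≤ d}` for every `d ≥ 1`.  From `genEllTwo_holds` (the `Σ = {2}` case) and the monotonicity of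
(ii) in `Σ`. [cite: MochizukiGenEll2010, Thm 2.1 p.11] -/
theorem genEll_thm21_subset_two (S : Finset ℕ) (hS : S ⊆ {2})
    (h : Literature.NumberTheory.DiophantineGeometry.GenEll.ABCCompactlyBounded S) (d : ℕ) (hd : 0 < d) :
    Literature.NumberTheory.DiophantineGeometry.GenEll.VojtaP1Deg d :=
  genEll_thm21_primes_of_subset_two genEllTwo_holds S hS h d hd

/-- The case `Σ = ∅` ("Vojta on EVERY compactly bounded subset of `U_P(Q̄)` implies uniform Vojta in every
bounded degree"), unconditionally. [cite: MochizukiGenEll2010, Thm 2.1 p.11] -/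
theorem genEll_thm21_empty
    (h : Literature.NumberTheory.DiophantineGeometry.GenEll.ABCCompactlyBounded ∅) (d : ℕ) (hd : 0 < d) :
    Literature.NumberTheory.DiophantineGeometry.GenEll.VojtaP1Deg d :=
  genEll_thm21_subset_two ∅ (Finset.empty_subset _) h d hd

/-- **Reduction of the fact-list row F-1336**: `GenEll_thm21_primes` (all finite prime sets `Σ`) holds
as soon as its cases `Σ ⊄ {2}` do — the cases `Σ ⊆ {2}` being the theorem above.
[cite: MochizukiGenEll2010, Thm 2.1 p.11] -/
theorem genEll_thm21_primes_of_not_subset_two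
    (hrest : ∀ S : Finset ℕ, (∀ p ∈ S, p.Prime) → ¬ S ⊆ {2} →
      Literature.NumberTheory.DiophantineGeometry.GenEll.ABCCompactlyBounded S →
        ∀ d : ℕ, 0 < d → Literature.NumberTheory.DiophantineGeometry.GenEll.VojtaP1Deg d) :
    Literature.NumberTheory.DiophantineGeometry.GenEll.GenEll_thm21_primes :=
  genEll_thm21_primes_of_two_of_not_subset genEllTwo_holds hrest

end Summit.ABC.ABC.Theorems

end
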